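import Summits.MatrixMultiplication.MatrixMultiplication.Theorems.AbelianSTPPCensusShapeCertVPSearch
import Summits.MatrixMultiplication.MatrixMultiplication.Theorems.AbelianSTPPCensusShapeCertFinal
import Summits.MatrixMultiplication.MatrixMultiplication.Theorems.AbelianSTPPSieveVP

/-!
# Abelian STPP census — soundness of `ShapeCertVP` (part 5: from the tree statement to the checker)

Cell mm-stpp, route `AbelianSTPPCensusVP`, crux `ShapeExclusionVP337` (stmt-MatrixMultiplication-19191); seat mm-stpp-theory.
The bridge from the route's vocabulary (`SieveAdmissibleVP`, `Beats`) to the checker's semantics: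
* `admG_GM` — the three letter forms of the tree's rule `U11G` (floor `t(P₁+P₂) − 2t² + 1` vs ceiling `UB(t) =
  Σ aᵢcᵢ·min(t,bᵢ) + t(M − P₃)`) give rule U11-G in CREDIT FORM for the shape multiset (`AdmG`): with `P₃ ≤ M`
  (packing), `UB(t) = Σ cr_t + tM − tP₃`, so the floor/ceiling inequality is `t·Σ(ab+bc+ca) + 1 ≤ tM + 2t² + Σ cr_t`;
* `beats_gsumV` — a beating family of order `M ≤ 337` has integer gain above `10⁶·M` (`gainV_pow_le`);
* `shapeExclusionVP_of_checkV` — **if `checkV M = true` (`M ≤ 337`) then no shape list with at least two members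
  satisfying `SieveAdmissibleVP M` beats `5/2`** (with eng-2's `inUniv_shp`, `admM_GM` for the vM part).
The per-order kernel evaluations and the crux by name are in `…ShapeCertVPEval*` / `…ShapeExclusionVP337`.
-/

set_option linter.dupNamespace false -- `MatrixMultiplication.MatrixMultiplication` (summit = problem, D-0017)
set_option autoImplicit false

namespace Summit.MatrixMultiplication.MatrixMultiplication.Theorems.ShapeCertVP

open ShapeCert Finset

section credit
/-! ### Rule U11-G in credit form from the tree's form B -/

variable {N : ℕ}

/-- the ceiling in credit form: with `P_CA ≤ M`, `UB_B(t) + t·P_CA = Σ cr_t + t·M`, where the credit of member `i` is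
`aᵢbᵢcᵢ` if `bᵢ < t` and `t·cᵢaᵢ` otherwise -/
theorem ubB_credit (M : ℕ) (a b c : Fin N → ℕ) (t : ℕ) (hP : pCA a b c ≤ M) :
    ubB M a b c t + t * pCA a b c = (∑ i, if b i < t then a i * b i * c i else t * (c i * a i)) + t * M := by
  unfold ubB
  have hs : (∑ i, a i * c i * min t (b i)) = ∑ i, (if b i < t then a i * b i * c i else t * (c i * a i)) := by
    refine sum_congr rfl fun i _ => ?_
    split_ifs with h
    · rw [min_eq_right h.le]; ring
    · rw [min_eq_left (not_lt.mp h)]; ring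
  rw [hs]
  have : t * (M - pCA a b c) + t * pCA a b c = t * M := by
    rw [← Nat.mul_add, Nat.sub_add_cancel hP]
  omega

/-- **form B in credit form**: `t·(P_AB + P_BC + P_CA) + 1 ≤ t·M + 2t² + Σ cr_t` at every admissible `t ≥ 3` -/
theorem credit_of_formB {M : ℕ} {a b c : Fin N → ℕ} (hP : pCA a b c ≤ M) (h : U11GFormB M a b c)
    {t : ℕ} (h3 : 3 ≤ t) (h1 : t ≤ pAB a b c) (h2 : t ≤ pBC a b c) (hl : t ≤ lB a b c t) :
    t * (pAB a b c + pBC a b c + pCA a b c) + 1 ≤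
      t * M + 2 * (t * t) + ∑ i, (if b i < t then a i * b i * c i else t * (c i * a i)) := by
  have hf := (h t (by omega) h1 h2 hl).2 h3
  have hc := ubB_credit M a b c t hP
  have e : t * (pAB a b c + pBC a b c + pCA a b c) = t * (pAB a b c + pBC a b c) + t * pCA a b c := by ring
  have e2 : 2 * t ^ 2 = 2 * (t * t) := by ring
  omega

/-- **rule U11-G in credit form for the shape multiset of a vP-admissible family** -/
theorem admG_GM {M : ℕ} (a b c : Fin N → ℕ) (hS : SieveAdmissible M a b c) (hG : U11G M a b c) :
    AdmG M (GM a b c) := by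
  obtain ⟨hB, hA, hC⟩ := hG
  have hU2 := hS.2.2.1
  have pab_le : pAB a b c ≤ M := hU2.1
  have pbc_le : pBC a b c ≤ M := hU2.2.1
  have pca_le : pCA a b c ≤ M := hU2.2.2
  intro r t h3 hp1 hp2 hfib
  simp only [sum_GM] at hp1 hp2 hfib ⊢
  match r with
  | 0 =>
    -- form B: letters (a, b, c)
    have := credit_of_formB pca_le hB h3 hp1 hp2 hfib
    simpa [uu, pab, pbc, pca, pAB, pBC, pCA, shp, crT, midT, xzT, vol, sum_add_distrib, mul_add] using this
  | 1 =>
    -- form A: letters (c, a, b)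
    have hP : pCA c a b ≤ M := by unfold pCA; unfold pBC at pbc_le; exact pbc_le
    have := credit_of_formB hP hA h3 (by simpa [pAB, p1T, shp, pca] using hp1) (by simpa [pBC, p2T, shp, pab] using hp2)
      (by simpa [lB, fibT, midT, mnxzT, shp] using hfib)
    simpa [uu, pab, pbc, pca, pAB, pBC, pCA, shp, crT, midT, xzT, vol, sum_add_distrib, mul_add, mul_comm, mul_left_comm,
      add_comm, add_left_comm, add_assoc] using this
  | r + 2 =>
    -- form C: letters (b, c, a)
    have hP : pCA b c a ≤ M := by unfold pCA; unfold pAB at pab_le; exact pab_le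
    have := credit_of_formB hP hC h3 (by simpa [pAB, p1T, shp, pbc] using hp1) (by simpa [pBC, p2T, shp, pca] using hp2)
      (by simpa [lB, fibT, midT, mnxzT, shp] using hfib)
    simpa [uu, pab, pbc, pca, pAB, pBC, pCA, shp, crT, midT, xzT, vol, sum_add_distrib, mul_add, mul_comm, mul_left_comm,
      add_comm, add_left_comm] using this

end credit

section gains
/-! ### Real gains versus integer gains (after eng-2's `rpow_le_gain`) -/

/-- `V^{5/6} ≤ gainV(V)/10⁶` for `V ≤ 337` -/
theorem rpow_le_gainV (V : ℕ) (hV : V ≤ 337) :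
    ((V : ℕ) : ℝ) ^ ((5 / 2 : ℝ) / 3) ≤ (gainV V : ℝ) / 1000000 := by
  have h := gainV_pow_le V hV
  have hx : (0 : ℝ) ≤ V := Nat.cast_nonneg V
  have hle : (V : ℝ) ^ 5 ≤ ((gainV V : ℝ) / 1000000) ^ 6 := by
    rw [div_pow, le_div_iff₀ (by positivity)]
    exact_mod_cast h
  have e1 : ((5 / 2 : ℝ) / 3) = ((5 : ℕ) : ℝ) * ((1 : ℝ) / 6) := by norm_num
  rw [e1, Real.rpow_natCast_mul hx]
  calc ((V : ℝ) ^ 5) ^ ((1 : ℝ) / 6) ≤ (((gainV V : ℝ) / 1000000) ^ 6) ^ ((1 : ℝ) / 6) :=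
        Real.rpow_le_rpow (pow_nonneg hx 5) hle (by norm_num)
    _ = (gainV V : ℝ) / 1000000 := by
        rw [show ((1 : ℝ) / 6) = ((6 : ℕ) : ℝ)⁻¹ by norm_num]
        exact Real.pow_rpow_inv_natCast (by positivity) (by norm_num)

variable {N : ℕ}

/-- a beating family of order `M ≤ 337` has integer gain above `10⁶·M` -/
theorem beats_gsumV {M : ℕ} (a b c : Fin N → ℕ) (hS : SieveAdmissible M a b c) (hM : M ≤ 337)
    (hB : Beats (5 / 2) M a b c) : M * D < gsumV (GM a b c) := by
  unfold Beats at hB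
  have hV : ∀ i, shapeVol a b c i ≤ 337 := fun i => by
    unfold SieveAdmissible at hS; dsimp only at hS; exact (hS.1 i).2.2.2.trans hM
  have hsum : (M : ℝ) < ∑ i, ((gainV (shapeVol a b c i) : ℝ) / 1000000) :=
    hB.trans_le (Finset.sum_le_sum fun i _ => rpow_le_gainV _ (hV i))
  rw [← Finset.sum_div, lt_div_iff₀ (by norm_num)] at hsum
  have h2 : M * 1000000 < ∑ i, gainV (shapeVol a b c i) := by exact_mod_cast hsum
  unfold gsumV D; rw [sum_GM]; exact h2

end gains

/-- **From the checker to the crux statement at one order.**  If `checkV M = true` (`M ≤ 337`), no shape list with at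
least two members satisfying the vP sieve system beats `5/2` at order `M`. -/
theorem shapeExclusionVP_of_checkV {M : ℕ} (hM : M ≤ 337) (hc : checkV M = true) :
    ∀ (N : ℕ) (a b c : Fin N → ℕ), 2 ≤ N → SieveAdmissibleVP M a b c → ¬ Beats (5 / 2) M a b c := by
  intro N a b c hN hVP hB
  obtain ⟨hS, hG, -⟩ := hVP
  exact checkV_sound hc hM (GM a b c)
    (fun x hx => by obtain ⟨i, rfl⟩ := (mem_GM a b c).mp hx; exact inUniv_shp a b c hN hS i)
    (admM_GM a b c hN hS) (admG_GM a b c hS hG) (beats_gsumV a b c hS hM hB)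

end Summit.MatrixMultiplication.MatrixMultiplication.Theorems.ShapeCertVP
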